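import Literature.AnabelianGeometry.EtaleTheta.SettingModelChiSemidirect
import Literature.AnabelianGeometry.EtaleTheta.SettingModelCuspAxis
import HarnessLib

/-!
# A model of the [EtTh] §1 root, reshape (B): Galois SECTIONS of `Π^tp_X = Γ ⋊_χ G_{ℚ_p}` twisted by a
# `χ`-cocycle along the `b`-axis (the decomposition groups of the `K̈`-points of `Ÿ` in the model)

Mochizuki, *The étale theta function …*, Publ. RIMS **45** (2009) [EtTh], §1, Prop. 1.4 (iii) p. 22
("if … `y ∈ Ÿ(L)` is a non-cuspidal point, then the restricted classes … `∈ H¹(G_L, Δ_Θ)`"), Def. 1.9 p. 29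
(the points `τ`, `τ⁻¹`) [cite: MochizukiEtTh2009, Prop 1.4 (iii) p.22]. Layer L2 of the abc-iut cell, seat
abc-iut-L2-t6 (gen 5): R78 cluster hand #4 (E-indexed VALUE layer, file map R100 F7), built OVER
abc-iut-w5-d249's F4 `SettingModelChiSemidirect.lean` (`PiTpχ = Gfp ⋊[actχ] GQp`, the induced topology
`isInducing_leftRightχ`, `augχ`, `continuous_inrχ`), abc-iut-L2-t1's `SettingModelSemidirectTopology`
(`Semidirect.continuous_iff_left_right`) and abc-iut-w5-d029's `SettingModelCuspAxis.lean` (`bPowGfp : Ẑ →ₜ* Γ`,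
`twistGfp_bPowGfp`) — consumed BY NAME, nothing restated. Class (b) CONSTRUCTIONS (sections are data).

WHY. In the semi-synthetic model a `K̈`-rational point of `Ÿ` IS a continuous section `s : G_K̈ → Π^tp_Ÿ` of the
augmentation (`ThetaCohomologySectionPoints`, `KummerDataOfCoreSection`): the untwisted Galois factor `inr` is
the CUSPIDAL section (`log(Ü)|_{inr} = 0`, coordinate `Ü = 1 ∈ ±q̈^ℤ`), and the points `τ`, `τ⁻¹` of Def. 1.9
(coordinates `√−1^{±1}`) are the sections TWISTED along the `b`-axis `b^Ẑ ≅ Ẑ(χ)` by (twice) the Kummer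
cocycle of `√−1^{±1}`. THIS FILE supplies the section mechanism:
* generic: `Semidirect.sectionOfCrossedHom` — a crossed homomorphism `c : G → N`
  (`c(gh) = c(g)·φ(g)(c(h))`) IS a homomorphic section `g ↦ ⟨c g, g⟩` of `N ⋊[φ] G ↠ G`; continuity from
  continuity of `c` for the induced topology;
* at the model: `sectionχ f` for a `χ`-COCYCLE `f : G_{ℚ_p} → Ẑ` (`f(στ) = f(σ)·χ(σ)(f(τ))`, `Ẑ` written
  multiplicatively), `σ ↦ ⟨b^{f σ}, σ⟩` — a homomorphism because `actχ σ (b^t) = b^{χ(σ) t}`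
  (`twistGfp_bPowGfp`); `augχ ∘ sectionχ f = id`, `continuous_sectionχ` (for continuous `f`), and
  `sectionχ 1 = inr`; (v2) membership in the coverings: `sectionχ_mem_YNχ_iff` (`f σ ∈ N·Ẑ ∧ σ ∈ G_{K_N}`),
  `inr_mem_YNχ_iff`, `sectionχ_sq_mem_YNχ_two`. The Kummer cocycles `κ_u` of units `u ∈ ℚ_p^×` read in `Ẑ(χ)` (abc-iut-L2-t5's F3c
  `kappaQ`-pattern) are such `f`; F7b takes `f := κ_{√−1}²`-type cocycles for `τ^{±1}`.
SEMI-SYNTHETIC MODEL, CONSISTENCY EVIDENCE ONLY; nothing of [EtTh] asserted; no side taken on [IUTchIII] Cor. 3.12.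
-/

noncomputable section

namespace Literature.AnabelianGeometry.EtaleTheta.SettingModel

open Literature.AnabelianGeometry.SemiGraphs _root_.Topology _root_.Function

/-! ### Generic: sections of a semidirect product from crossed homomorphisms -/

namespace Semidirect

variable {N G : Type*} [Group N] [Group G] {φ : G →* MulAut N}

/-- **A crossed homomorphism is a section**: for `c : G → N` with `c(gh) = c(g)·φ(g)(c(h))`, the map
`g ↦ ⟨c g, g⟩ : G → N ⋊[φ] G` is a group homomorphism. [cite: MochizukiEtTh2009, Prop 1.4 (iii) p.22] -/
def sectionOfCrossedHom (c : G → N) (hc : ∀ g h : G, c (g * h) = c g * φ g (c h)) : G →* N ⋊[φ] G where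
  toFun g := ⟨c g, g⟩
  map_one' := by
    have h1 : c 1 = 1 := by
      have h := hc 1 1
      rw [one_mul, map_one, MulAut.one_apply] at h
      exact mul_eq_left.mp h.symm
    ext <;> simp [h1]
  map_mul' g h := by
    ext <;> simp [hc]

/-- [cite: MochizukiEtTh2009, Prop 1.4 (iii) p.22] -/
@[simp] theorem sectionOfCrossedHom_left (c : G → N) (hc : ∀ g h : G, c (g * h) = c g * φ g (c h)) (g : G) :
    (sectionOfCrossedHom c hc g).left = c g := rfl

/-- [cite: MochizukiEtTh2009, Prop 1.4 (iii) p.22] -/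
@[simp] theorem sectionOfCrossedHom_right (c : G → N) (hc : ∀ g h : G, c (g * h) = c g * φ g (c h)) (g : G) :
    (sectionOfCrossedHom c hc g).right = g := rfl

/-- It is a section of `rightHom`. [cite: MochizukiEtTh2009, Prop 1.4 (iii) p.22] -/
theorem rightHom_sectionOfCrossedHom (c : G → N) (hc : ∀ g h : G, c (g * h) = c g * φ g (c h)) (g : G) :
    SemidirectProduct.rightHom (sectionOfCrossedHom c hc g) = g := rfl

/-- The trivial crossed homomorphism gives the standard section `inr`. [cite: MochizukiEtTh2009, Prop 1.4 (iii) p.22] -/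
theorem sectionOfCrossedHom_one (g : G) :
    sectionOfCrossedHom (φ := φ) (fun _ => (1 : N)) (fun _ _ => by rw [map_one, mul_one]) g =
      SemidirectProduct.inr g := rfl

/-- Continuity: for the topology induced along `g ↦ (g.left, g.right)`, the section is continuous as soon as the
crossed homomorphism is. [cite: MochizukiEtTh2009, Prop 1.4 (iii) p.22] -/
theorem continuous_sectionOfCrossedHom [TopologicalSpace N] [TopologicalSpace G] [TopologicalSpace (N ⋊[φ] G)]
    (hι : IsInducing fun g : N ⋊[φ] G => (g.left, g.right)) (c : G → N)
    (hc : ∀ g h : G, c (g * h) = c g * φ g (c h)) (hcont : Continuous c) :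
    Continuous (sectionOfCrossedHom c hc) :=
  (continuous_iff_left_right hι).2 ⟨hcont, continuous_id⟩

/-- The image of the section meets the kernel `inl(N)` trivially: an element of the image with trivial `G`-part
is trivial. [cite: MochizukiEtTh2009, Prop 1.4 (iii) p.22] -/
theorem sectionOfCrossedHom_injective (c : G → N) (hc : ∀ g h : G, c (g * h) = c g * φ g (c h)) :
    Injective (sectionOfCrossedHom c hc) := fun g h hgh => by
  have := congrArg SemidirectProduct.right hgh
  exact this

end Semidirect

/-! ### At the χ-twisted model: sections twisted along the `b`-axis by a `χ`-cocycle -/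

variable (p : ℕ) [Fact p.Prime]

/-- **The `b`-axis section of `Π^tp_X = Γ ⋊_χ G_{ℚ_p}` twisted by a `χ`-cocycle** `f : G_{ℚ_p} → Ẑ`
(`f(στ) = f(σ)·χ(σ)(f(τ))`): `σ ↦ ⟨b^{f σ}, σ⟩`. [cite: MochizukiEtTh2009, Prop 1.4 (iii) p.22] -/
def sectionχ (f : GQp p → ZH) (hf : ∀ σ τ : GQp p, f (σ * τ) = f σ * chi p σ (f τ)) : GQp p →* PiTpχ p :=
  Semidirect.sectionOfCrossedHom (fun σ => bPowGfp (f σ)) fun σ τ => by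
    rw [hf, map_mul, actχ_apply, twistGfp_bPowGfp]

variable (f : GQp p → ZH) (hf : ∀ σ τ : GQp p, f (σ * τ) = f σ * chi p σ (f τ))

/-- [cite: MochizukiEtTh2009, Prop 1.4 (iii) p.22] -/
@[simp] theorem sectionχ_left (σ : GQp p) : (sectionχ p f hf σ).left = bPowGfp (f σ) := rfl

/-- [cite: MochizukiEtTh2009, Prop 1.4 (iii) p.22] -/
@[simp] theorem sectionχ_right (σ : GQp p) : (sectionχ p f hf σ).right = σ := rfl

/-- **`augχ ∘ sectionχ f = id`**: twisted sections are sections of the augmentation.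
[cite: MochizukiEtTh2009, Prop 1.4 (iii) p.22] -/
theorem augχ_sectionχ (σ : GQp p) : augχ p (sectionχ p f hf σ) = σ := rfl

/-- The same for the augmentation field of the model's tempered curve `curveχ`. [cite: MochizukiEtTh2009, Prop 1.4 (iii) p.22] -/
theorem aug_curveχ_sectionχ (σ : GQp p) : (curveχ p).aug (sectionχ p f hf σ) = σ := rfl

/-- **Continuity** of the twisted section for continuous `f` (`b^· : Ẑ → Γ` is continuous, the topology of
`Π^tp_X` is induced from `Γ × G_{ℚ_p}`). [cite: MochizukiEtTh2009, Prop 1.4 (iii) p.22] -/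
theorem continuous_sectionχ (hfc : Continuous f) : Continuous (sectionχ p f hf) :=
  Semidirect.continuous_sectionOfCrossedHom (isInducing_leftRightχ p) _ _ (bPowGfp.continuous.comp hfc)

/-- The twisted section is injective. [cite: MochizukiEtTh2009, Prop 1.4 (iii) p.22] -/
theorem sectionχ_injective : Injective (sectionχ p f hf) :=
  Semidirect.sectionOfCrossedHom_injective _ _

/-- The untwisted case `f = 1` is the Galois factor `inr`. [cite: MochizukiEtTh2009, Prop 1.4 (iii) p.22] -/
theorem sectionχ_one (σ : GQp p) :
    sectionχ p (fun _ => 1) (fun _ _ => by rw [map_one, mul_one]) σ = SemidirectProduct.inr σ := by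
  refine SemidirectProduct.ext ?_ rfl
  rw [sectionχ_left, map_one, SemidirectProduct.left_inr]

/-- The image of a twisted section lies over its cocycle: `(sectionχ f σ).left ∈ b^Ẑ`.
[cite: MochizukiEtTh2009, Prop 1.4 (iii) p.22] -/
theorem sectionχ_left_mem_bAxisGfp (σ : GQp p) : (sectionχ p f hf σ).left ∈ bAxisGfp :=
  bPowGfp_mem_bAxisGfp _

/-- The degree of a twisted section's `Γ`-component is `0` (`pr₂ (b^t) = 1`): twisted sections lie in `Π^tp_Y`'s
`Γ`-direction kernel of the degree. [cite: MochizukiEtTh2009, Prop 1.4 (iii) p.22] -/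
theorem gfpSnd_sectionχ_left (σ : GQp p) : gfpSnd (sectionχ p f hf σ).left = 1 := rfl

/-! ### Membership of twisted sections in the coverings `Y_N` of the χ-model (v2, abc-iut-L2-t6 gen 5) -/

/-- `ĥ_N` of `b^t ∈ Γ` is `(0, t mod N, 0)`. [cite: MochizukiEtTh2009, §1 p.13] -/
theorem levelHom_bPowGfp (N : ℕ+) (t : ZH) :
    levelHom N (bPowGfp t) = ⟨0, Multiplicative.toAdd (ZHatLevel.level N t), 0⟩ := by
  change hHat N (gfpFst (bPowGfp t)) = _
  rw [gfpFst_apply, coe_bPowGfp, hHat_bPow]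

/-- **`b^t ∈ Δ^tp_{Y_N} ↔ t ∈ N·Ẑ`** (`Δ^tp_{Y_N} = {degree 0, ĥ_N ∈ z-axis}`). [cite: MochizukiEtTh2009, §1 p.13] -/
theorem bPowGfp_mem_dY_iff (N : ℕ+) (t : ZH) : bPowGfp t ∈ dY N ↔ ZHatLevel.level N t = 1 := by
  change bPowGfp t ∈ gfpSnd.ker ⊓ _ ↔ _
  rw [Subgroup.mem_inf, MonoidHom.mem_ker, gfpSnd_bPowGfp, Subgroup.mem_comap, levelHom_bPowGfp]
  change (1 : Multiplicative ℤ) = 1 ∧ ((0 : ZMod N) = 0 ∧ Multiplicative.toAdd (ZHatLevel.level N t) = 0) ↔ _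
  simp only [true_and]
  constructor
  · intro h
    rw [← ofAdd_toAdd (ZHatLevel.level N t), h, ofAdd_zero]
  · intro h
    rw [h, toAdd_one]

/-- **A twisted section lies in `Π^tp_{Y_N}` at `σ` iff `f σ ∈ N·Ẑ` and `σ ∈ G_{K_N}`.**
[cite: MochizukiEtTh2009, §1 p.13] -/
theorem sectionχ_mem_YNχ_iff (N : ℕ+) (σ : GQp p) :
    sectionχ p f hf σ ∈ YNχ p N ↔
      ZHatLevel.level N (f σ) = 1 ∧ σ ∈ (fieldKN ⊥ (qModel p) N).fixingSubgroup := by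
  change (sectionχ p f hf σ).left ∈ dY N ∧ (sectionχ p f hf σ).right ∈ _ ↔ _
  rw [sectionχ_left, sectionχ_right, bPowGfp_mem_dY_iff]

/-- The Galois factor `inr σ` lies in `Π^tp_{Y_N}` iff `σ ∈ G_{K_N}`. [cite: MochizukiEtTh2009, §1 p.13] -/
theorem inr_mem_YNχ_iff (N : ℕ+) (σ : GQp p) :
    (SemidirectProduct.inr σ : PiTpχ p) ∈ YNχ p N ↔ σ ∈ (fieldKN ⊥ (qModel p) N).fixingSubgroup := by
  rw [← sectionχ_one p σ, sectionχ_mem_YNχ_iff, map_one]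
  exact ⟨fun h => h.2, fun h => ⟨rfl, h⟩⟩

/-- A section twisted by a SQUARE `f = k·k` (multiplicative `Ẑ`; additively `2k`) lies in `Π^tp_{Y_2}` over
`G_{K_2}` — the `Ÿ`-membership of the points `τ^{±1}` (twist `κ_u²`). [cite: MochizukiEtTh2009, Def 1.9 p.29] -/
theorem sectionχ_sq_mem_YNχ_two {k : GQp p → ZH} (hk : ∀ σ τ : GQp p, k (σ * τ) = k σ * chi p σ (k τ))
    (hkk : ∀ σ τ : GQp p, (k * k) (σ * τ) = (k * k) σ * chi p σ ((k * k) τ)) (σ : GQp p)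
    (hσ : σ ∈ (fieldKN ⊥ (qModel p) 2).fixingSubgroup) : sectionχ p (k * k) hkk σ ∈ YNχ p 2 := by
  refine (sectionχ_mem_YNχ_iff p (k * k) hkk 2 σ).2 ⟨?_, hσ⟩
  have _ := hk
  rw [Pi.mul_apply, map_mul]
  generalize ZHatLevel.level 2 (k σ) = c
  rw [← ofAdd_toAdd c, ← ofAdd_add, ← two_nsmul]
  change Multiplicative.ofAdd ((2 : ℕ) • Multiplicative.toAdd c) = 1
  rw [nsmul_eq_mul]
  have h2 : ((2 : ℕ) : ZMod (2 : ℕ+)) = 0 := by decide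
  rw [h2, zero_mul, ofAdd_zero]

end Literature.AnabelianGeometry.EtaleTheta.SettingModel

end
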